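import Literature.NumberTheory.LFunctions.SelbergClassZeroCounting
import Literature.NumberTheory.LFunctions.SekatskiiGeneralizedBombieriLagarias
import HarnessLib

/-!
# Li's criterion for the Selberg class (Omar–Mazhouda, Smajlović) and its Sekatskii/Mazhouda shift

LABEL (line 1): **RH-EQUIVALENT (for `F ∈ 𝒮`)** — for every Selberg datum `F`, the typed criteria
"`Re λ_F(n) ≥ 0 ∀ n ≥ 1`" and "`Re λ_F(n,a) ≥ 0 ∀ n ≥ 1`" (`a ≠ ½`) ARE the Riemann hypothesis for `F`
(PROVED here from the tree's Bombieri–Lagarias / Sekatskii theorems, modulo one convergence fact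
`Σ_ρ m(ρ)/(1+|ρ|²) < ∞` over the non-trivial zeros of `F`), plus the RH_F-equivalent ASYMPTOTIC of
`λ_F(n)` (Omar–Mazhouda II, named fact).  bears_on: LADDER-RH L-C (COLUMN 4, LI; Selberg-class
row).  WHAT THIS IS NOT: for `F = ζ` this is Li's criterion re-proved; for general `F` it fixes which
inequality IS RH_F; nothing here bears on the truth of RH (or of GRH for any `F`).

Sources.  PRIMARY (not held — ScienceDirect 403, acquisition `acq-08567`): S. Omar, K. Mazhouda,
*Le critère de Li et l'hypothèse de Riemann pour la classe de Selberg*, J. Number Theory **125** (2007)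
50–58 [OmarMazhouda2007] (+ corrigendum, JNT 130 (2010) 1109–1114); *The Li criterion and the Riemann
hypothesis for the Selberg class II*, JNT **130** (2010) 1098–1108 [OmarMazhouda2010];
L. Smajlović, *On Li's criterion for the Riemann hypothesis for the Selberg class*, JNT **130** (2010)
828–851 [Smajlovic2010].  SECONDARY, HELD, by one of the authors, restating all of these with formulas:
K. Mazhouda, *Reformulation of the Li criterion for the Selberg class*, arXiv:1405.7354 (2014)
[Mazhouda2014LiSelberg] (`lit read paper:arxiv-1405.7354`; locators `pNNNN:Lnn` below), which also
carries Sekatskii's shifted criterion over to `𝒮` (its Lemma 1, Thms 4–5 — the "Li–Sekatskii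
coefficients", cf. Mazhouda–Sodaïgui, Int. J. Math. 33 (2022)).  Statements are typed from the
secondary and cite both.

## Dictionary (paper ↦ tree)

* `F ∈ 𝒮` ↦ a `SelbergDatum` `D` (tree `SelbergClass.lean`; `F = D.toFun`, `Φ_F = D.completed`,
  `d_F = D.degree`, `Q_F = D.Q`, `λ_j = D.lam j`).
* "non-trivial zeros of `F`" = zeros of `ξ_F(s) = s^{m_F}(s−1)^{m_F}Φ_F(s)` (p0004:L1–8), which lie in
  the critical strip; typed as the zeros of `F` in the OPEN strip `0 < Re s < 1` —
  `SelbergDatum.nontrivialZeros` — the same strip form as the tree's `SelbergDatum.RiemannHypothesis`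
  (zeros of `F ∈ 𝒮` on `Re s = 1` do not exist by Kaczorowski–Perelli's non-vanishing theorem, and
  on `Re s = 0` correspondingly; that identification is not needed for anything below).
* multiplicity `m(ρ)` ↦ `SelbergDatum.zeroMult ρ` = the order of `Φ_F` at `ρ` (the convention of the
  tree's `SelbergDatum.exists_sum_order_window_le`), `= ord_ρ F` in the open strip.
* `λ_F(n) = Σ*_ρ [1 − (1 − 1/ρ)ⁿ]` (p0004:L26–30, `*` = `lim_{T→∞} Σ_{|Im ρ| ≤ T}`), whose REAL PART
  "converges absolutely for all integer `n`" (p0004:L44–48, Bombieri–Lagarias' lemma) ↦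
  `SelbergDatum.liCoeffRe n := Σ' ρ, m(ρ)·Re[1 − (1 − 1/ρ)ⁿ]` (only the real parts enter the
  criterion; for `F` with real coefficients `λ_F(n)` is real).  Likewise the "modified Li coefficient"
  `λ_F(n,a) = Σ_ρ [1 − ((ρ−a)/(ρ+a−1))ⁿ]` (p0002:L5, p0006:L5–13) ↦ `SelbergDatum.liSekatskiiRe a n`.

## Contents (source item ↦ declaration)

* defs: `nontrivialZeros`, `zeroMult`, `liCoeffRe`, `liSekatskiiRe`, `liAsymptoticConst`
  (`c_F = (d_F/2)(γ−1) + ½ log(λ Q_F²)`, `λ = Π λ_j^{2λ_j}`, p0005:L23–25).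
* PROVED: `one_sub_conj_mem_nontrivialZeros` (the zero set is invariant under `ρ ↦ 1 − ρ̄`,
  p0004:L36, from the functional equation), `zeroMult_pos`, `riemannHypothesis_iff_forall_re_le_half`.
* NAMED FACT `SelbergDatum.LiZeroSumSummable D : Σ_ρ m(ρ)/(1 + |ρ|²) < ∞` (p0004:L40–43: "since `ξ_F`
  is an entire function of order 1 and its zeros lie in the critical strip, the series
  `Σ_ρ (1+|Re ρ|)/(1+|ρ|)²` is convergent"); dischargeable from the tree's window count
  `SelbergDatum.exists_sum_order_window_le` (`O(log t)` zeros per unit window).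
* Thm 1 (p0004:L60; = Omar–Mazhouda 2007 Thm 1 / Smajlović 2010 Thm 4.3):
  `riemannHypothesis_iff_liCoeffRe_nonneg` — PROVED modulo `LiZeroSumSummable`
  (`bombieriLagarias1999_theorem1_pos`); with the bounded-below strengthening
  `riemannHypothesis_of_liCoeffRe_bddBelow` and Thm 1 (a) (subexponential lower bound suffices)
  `riemannHypothesis_of_liCoeffRe_subexp`, conditional on `Sekatskii2014_thm2c`.
  TYPING NOTE: the secondary prints "`Re(λ_F(n)) > 0`"; Li, Bombieri–Lagarias and Smajlović state the
  criterion with `≥ 0`, which is what is typed (and proved).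
* Thm 5 (p0006:L91–97; modified criterion): `riemannHypothesis_iff_liSekatskiiRe_nonneg` (`a < ½`:
  `≥ 0`; the footnote's `a > ½` case reads, for the typed real-part sums which satisfy
  `Re λ_F(n,1−a) = Re λ_F(n,a)`, again `≥ 0` — see the docstring) — PROVED modulo `LiZeroSumSummable`
  (`sekatskii2014_thm2_of_lt/_gt`).
* Thm 3 (p0005:L19–27; = Omar–Mazhouda 2010 (II)): NAMED FACT `OmarMazhouda2010_liCoeff_asymptotic`
  (`RH_F ⟺ Re λ_F(n) = (d_F/2) n log n + c_F n + O(√n log n)`), RH_F-EQUIVALENT; its `⟸` half is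
  PROVED unconditionally (`riemannHypothesis_of_liCoeff_asymptotic`, via
  `riemannHypothesis_of_liCoeffRe_ge_neg_pow`: any polynomial lower bound `Re λ_F(n) ≥ −K n^k`
  already gives RH_F) — only the `⟹` half (Lagarias-type evaluation under RH_F) remains a fact.

## Deliberately NOT here

Thm 2 / Thm 6 of the secondary (the ARITHMETIC FORMULAE for `λ_F(−n)` and `λ_F(−n,a)` via the Weil
explicit formula, = Omar–Mazhouda 2007 Thm 2 as corrected in the 2010 corrigendum): they involve the
minimal polar order `m_F`, the chosen Euler coefficients `b(n)` (under `∃` in `SelbergDatum`) and a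
Landau-type zero-free region hypothesis `ℋ`, and the primary's printed form needed a corrigendum —
deferred until the primary (acq-08567) is held.  Thm 7 (asymptotic of `λ_F(n,a)`; the preprint's
constants are internally inconsistent: `C_F(a)` is defined twice differently).  Thm 1 (b)
(`lim |λ_F(n)|^{1/n} ≤ 1`).  The identification of `λ_F(n)` with Taylor coefficients of
`log ξ_F(1/(1−z))` (p0004:L50–58).

## References

* [OmarMazhouda2007] S. Omar, K. Mazhouda, J. Number Theory 125 (2007) 50–58, Thm 1–2.
* [OmarMazhouda2010] S. Omar, K. Mazhouda, J. Number Theory 130 (2010) 1098–1108 (II), main theorem.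
* [Smajlovic2010] L. Smajlović, J. Number Theory 130 (2010) 828–851, Thm 4.3.
* [Mazhouda2014LiSelberg] K. Mazhouda, arXiv:1405.7354, Thm 1 (p. 4), Thm 3 (p. 5), Lemma 1, Thm 5 (p. 6).
* [BombieriLagarias1999] E. Bombieri, J. C. Lagarias, J. Number Theory 77 (1999), Thm 1.
* [Sekatskii2014] S. K. Sekatskii, Ukr. Math. J. 66 (2014), Thms 1–2.
-/

noncomputable section

open Complex Filter Topology Set
open scoped ComplexConjugate

namespace Literature.NumberTheory.LFunctions

namespace SelbergDatum

variable (D : SelbergDatum)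

/-! ### Non-trivial zeros and multiplicities -/

/-- The **non-trivial zeros** of `F ∈ 𝒮`: the zeros of `F` in the open critical strip
`0 < Re s < 1` (the zeros of `ξ_F(s) = s^{m_F}(s−1)^{m_F}Φ_F(s)` off the lines `Re s = 0, 1`; strip form
matching `SelbergDatum.RiemannHypothesis`). [cite: Mazhouda2014LiSelberg, §2 (p. 4)] -/
def nontrivialZeros : Set ℂ :=
  {ρ | D.toFun ρ = 0 ∧ 0 < ρ.re ∧ ρ.re < 1}

/-- The **multiplicity** `m(ρ)` of `ρ` as a zero of the completed function `Φ_F` (`= ord_ρ F` in the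
open strip, where the gamma factor is an analytic unit), as a natural number (`0` off the zeros).
[cite: Mazhouda2014LiSelberg, §2, eq. (2) ("ord ρ")] -/
def zeroMult (ρ : ℂ) : ℕ :=
  ((meromorphicOrderAt D.completed ρ).untop₀).toNat

variable {D}

/-- Membership unfolding. [cite: Mazhouda2014LiSelberg, §2 (p. 4)] -/
theorem mem_nontrivialZeros_iff {ρ : ℂ} :
    ρ ∈ D.nontrivialZeros ↔ D.toFun ρ = 0 ∧ 0 < ρ.re ∧ ρ.re < 1 := Iff.rfl

/-- A non-trivial zero is `≠ 0` and `≠ 1`. [folklore] -/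
private theorem ne_zero_and_ne_one_of_mem {ρ : ℂ} (h : ρ ∈ D.nontrivialZeros) : ρ ≠ 0 ∧ ρ ≠ 1 := by
  obtain ⟨-, h0, h1⟩ := h
  constructor
  · rintro rfl; simp at h0
  · rintro rfl; simp at h1

/-- **The multiset of non-trivial zeros is invariant under `ρ ↦ 1 − ρ̄`** (p. 4: "The multi-set `𝒵` is
invariant under the map `ρ ↦ 1 − ρ̄`"): from the functional equation
`Q^s ∏Γ(λ_j s + μ_j) F(s) = ω Q^{1−s} ∏Γ(λ_j(1−s) + μ̄_j) conj F(1 − s̄)` on the open strip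
(`functional_equation_conj`), the gamma factors and `Q^{1−s}`, `ω` being non-zero there.  PROVED.
[cite: Mazhouda2014LiSelberg, §2 (p. 4)] -/
theorem one_sub_conj_mem_nontrivialZeros {ρ : ℂ} (h : ρ ∈ D.nontrivialZeros) :
    1 - conj ρ ∈ D.nontrivialZeros := by
  obtain ⟨hz, h0, h1⟩ := h
  refine ⟨?_, by simp; linarith, by simp; linarith⟩
  have hFE := D.functional_equation_conj ρ h0 h1
  rw [hz, mul_zero] at hFE
  have hne : D.rootNumber * ((D.Q : ℂ) ^ (1 - ρ) *
      ∏ j, Gamma (D.lam j * (1 - ρ) + conj (D.mu j))) ≠ 0 := by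
    refine mul_ne_zero D.rootNumber_ne_zero (mul_ne_zero ?_ ?_)
    · rw [Ne, Complex.cpow_eq_zero_iff, not_and_or]
      exact Or.inl D.Q_ne_zero
    · exact Finset.prod_ne_zero_iff.2 fun j _ ↦ D.Gamma_lam_mul_one_sub_add_conj_mu_ne_zero ρ h1 j
  have : conj (D.toFun (1 - conj ρ)) = 0 := by
    have h2 : D.rootNumber * ((D.Q : ℂ) ^ (1 - ρ) *
        ∏ j, Gamma (D.lam j * (1 - ρ) + conj (D.mu j))) * conj (D.toFun (1 - conj ρ)) = 0 := by
      rw [← hFE.symm]; ring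
    exact (mul_eq_zero.1 h2).resolve_left hne
  simpa using this

/-- RH for `F` (strip form) iff every non-trivial zero has `Re ρ ≤ ½` (reflection `ρ ↦ 1 − ρ̄`),
iff every non-trivial zero has `Re ρ ≥ ½`. PROVED. [cite: Mazhouda2014LiSelberg, §2 (p. 4)] -/
theorem riemannHypothesis_iff_forall_re_le_half :
    D.RiemannHypothesis ↔ ∀ ρ : D.nontrivialZeros, (ρ : ℂ).re ≤ 1 / 2 := by
  constructor
  · intro h ρ
    obtain ⟨hz, h0, h1⟩ := ρ.2
    exact (h ρ hz h0 h1).le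
  · intro h s hs h0 h1
    have hle := h ⟨s, hs, h0, h1⟩
    have hge := h ⟨1 - conj s, one_sub_conj_mem_nontrivialZeros ⟨hs, h0, h1⟩⟩
    simp only [sub_re, one_re, conj_re] at hge
    simp only at hle
    linarith

/-- Dual form: RH for `F` iff every non-trivial zero has `Re ρ ≥ ½`. PROVED.
[cite: Mazhouda2014LiSelberg, §2 (p. 4)] -/
theorem riemannHypothesis_iff_forall_half_le_re :
    D.RiemannHypothesis ↔ ∀ ρ : D.nontrivialZeros, 1 / 2 ≤ (ρ : ℂ).re := by
  rw [riemannHypothesis_iff_forall_re_le_half]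
  constructor
  · intro h ρ
    have := h ⟨1 - conj (ρ : ℂ), one_sub_conj_mem_nontrivialZeros ρ.2⟩
    simp only [sub_re, one_re, conj_re] at this
    linarith
  · intro h ρ
    have := h ⟨1 - conj (ρ : ℂ), one_sub_conj_mem_nontrivialZeros ρ.2⟩
    simp only [sub_re, one_re, conj_re] at this
    linarith

/-- **Multiplicities of non-trivial zeros are positive**: `Φ_F` is analytic at `ρ` (open strip,
`ρ ≠ 1`), vanishes there (`F(ρ) = 0`), and is not identically zero near `ρ` (its order is that of the
entire `(s−1)^m F(s)`, `SelbergDatum.meromorphicOrderAt_completed_eq_of_entire`, which is non-zero at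
`s = 2` by the Euler product and analytic on the connected `ℂ`). PROVED.
[cite: Mazhouda2014LiSelberg, §2, eq. (2)] -/
theorem zeroMult_pos {ρ : ℂ} (h : ρ ∈ D.nontrivialZeros) : 0 < D.zeroMult ρ := by
  obtain ⟨hz, h0, h1⟩ := h
  have hρne : ρ ≠ 1 := (ne_zero_and_ne_one_of_mem ⟨hz, h0, h1⟩).2
  obtain ⟨G, hG, hGF⟩ := D.differentiable
  have hordG := D.meromorphicOrderAt_completed_eq_of_entire hG hGF h0 h1
  have hGan : AnalyticAt ℂ G ρ := hG.analyticAt ρ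
  -- `G` is not identically zero near `ρ`: `G(2) = F(2) ≠ 0` and `ℂ` is preconnected
  have hGtop : analyticOrderAt G ρ ≠ ⊤ := by
    intro htop
    have hGan' : AnalyticOnNhd ℂ G Set.univ := hG.differentiableOn.analyticOnNhd isOpen_univ
    have hG2 : G 2 = 0 :=
      hGan'.eqOn_zero_of_preconnected_of_eventuallyEq_zero
        isPreconnected_univ (Set.mem_univ ρ) (analyticOrderAt_eq_top.mp htop) (Set.mem_univ 2)
    rw [hGF 2 (by norm_num)] at hG2
    exact (mul_ne_zero (pow_ne_zero _ (by norm_num)) (D.toFun_ne_zero_of_one_lt_re 2 (by norm_num)))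
      hG2
  -- and `G(ρ) = 0`
  have hGρ : G ρ = 0 := by rw [hGF ρ hρne, hz, mul_zero]
  have hpos : 0 < analyticOrderAt G ρ := by
    rw [pos_iff_ne_zero, Ne, hGan.analyticOrderAt_eq_zero]
    exact not_not.2 hGρ
  obtain ⟨k, hk⟩ := ENat.ne_top_iff_exists.mp hGtop
  unfold zeroMult
  rw [hordG, hGan.meromorphicOrderAt_eq, ← hk]
  rw [← hk] at hpos
  have hk0 : 0 < k := by exact_mod_cast hpos
  simp [hk0]

/-! ### The Li coefficients (real parts) and the convergence fact -/

variable (D)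

/-- **`Re λ_F(n)`**, the real part of the `n`-th Li coefficient of `F ∈ 𝒮`,
`λ_F(n) = Σ*_ρ [1 − (1 − 1/ρ)ⁿ]` (p. 4), as the absolutely convergent sum
`Σ' ρ, m(ρ)·Re[1 − (1 − 1/ρ)ⁿ]` over the non-trivial zeros with multiplicity ("`Re λ_F(n)
= Σ_ρ Re[1 − (1 − 1/ρ)ⁿ]` converges absolutely for all integer `n`", p. 4, by Bombieri–Lagarias'
lemma; absolute convergence holds under `LiZeroSumSummable`, `summable_liTerm`).
[cite: Mazhouda2014LiSelberg, §2 (p. 4); OmarMazhouda2007, §1] -/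
def liCoeffRe (n : ℕ) : ℝ :=
  ∑' ρ : D.nontrivialZeros, (D.zeroMult ρ : ℝ) * (1 - (1 - 1 / (ρ : ℂ)) ^ n).re

/-- **`Re λ_F(n,a)`**, the real part of the modified ("Li–Sekatskii") coefficient
`λ_F(n,a) = Σ_ρ [1 − ((ρ − a)/(ρ + a − 1))ⁿ]` (abstract and §3, p. 6), as the absolutely convergent
sum of real parts with multiplicities. [cite: Mazhouda2014LiSelberg, §3 (p. 6)] -/
def liSekatskiiRe (a : ℝ) (n : ℕ) : ℝ :=
  ∑' ρ : D.nontrivialZeros,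
    (D.zeroMult ρ : ℝ) * (1 - (((ρ : ℂ) - a) / ((ρ : ℂ) + a - 1)) ^ n).re

/-- **The convergence fact** (p. 4: "Since `ξ_F(s)` is an entire function of order 1, and its zeros
lie in the critical strip, the series `Σ_ρ (1+|Re ρ|)/(1+|ρ|)²` is convergent") in the equivalent
form `Σ_ρ m(ρ)/(1 + |ρ|²) < ∞` over the non-trivial zeros with multiplicity (for `0 < Re ρ < 1` the
two weights are within a factor `4` of each other).  NAMED FACT per datum; dischargeable from the
tree's `SelbergDatum.exists_sum_order_window_le` (`O(log t)` zeros in each unit window).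
[cite: Mazhouda2014LiSelberg, §2 (p. 4); Smajlovic2010, §4] -/
def LiZeroSumSummable : Prop :=
  Summable fun ρ : D.nontrivialZeros ↦ (D.zeroMult ρ : ℝ) / (1 + ‖(ρ : ℂ)‖ ^ 2)

variable {D}

/-- Under the convergence fact, Bombieri–Lagarias' weight of the reflected family `1 − ρ̄` is summable
(`(1+|Re(1−ρ̄)|)/(1+|1−ρ̄|)² ≤ 8/(1+|ρ|²)` for `0 < Re ρ < 1`). [cite: Mazhouda2014LiSelberg, §2 (p. 4)] -/
theorem summable_blWeight_reflected (h : D.LiZeroSumSummable) :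
    Summable (BombieriLagarias.weight (fun ρ : D.nontrivialZeros ↦ 1 - conj (ρ : ℂ))
      (fun ρ ↦ D.zeroMult ρ)) := by
  refine Summable.of_nonneg_of_le (fun ρ ↦ BombieriLagarias.weight_nonneg _ _ ρ) (fun ρ ↦ ?_)
    (h.mul_left 8)
  obtain ⟨-, h0, h1⟩ := ρ.2
  unfold BombieriLagarias.weight
  have hm : (0 : ℝ) ≤ D.zeroMult ρ := Nat.cast_nonneg _
  have hre : 1 + |(1 - conj (ρ : ℂ)).re| ≤ 2 := by
    simp only [sub_re, one_re, conj_re]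
    rw [abs_of_pos (by linarith)]; linarith
  -- `1 + |ρ|² ≤ 4 (1 + |1 − ρ̄|)²` since `|ρ| ≤ |1 − ρ̄| + 1`
  have hnorm : ‖(ρ : ℂ)‖ ≤ ‖1 - conj (ρ : ℂ)‖ + 1 := by
    have : (ρ : ℂ) = -(conj (1 - conj (ρ : ℂ))) + 1 := by simp
    calc ‖(ρ : ℂ)‖ = ‖-(conj (1 - conj (ρ : ℂ))) + 1‖ := by rw [← this]
      _ ≤ ‖-(conj (1 - conj (ρ : ℂ)))‖ + ‖(1 : ℂ)‖ := norm_add_le _ _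
      _ = ‖1 - conj (ρ : ℂ)‖ + 1 := by rw [norm_neg, Complex.norm_conj, norm_one]
  have hden : 1 + ‖(ρ : ℂ)‖ ^ 2 ≤ 4 * (1 + ‖1 - conj (ρ : ℂ)‖) ^ 2 := by
    nlinarith [norm_nonneg (ρ : ℂ), norm_nonneg (1 - conj (ρ : ℂ))]
  have hpos : 0 < (1 + ‖1 - conj (ρ : ℂ)‖) ^ 2 := by positivity
  have hpos' : 0 < 1 + ‖(ρ : ℂ)‖ ^ 2 := by positivity
  calc (D.zeroMult ρ : ℝ) * ((1 + |(1 - conj (ρ : ℂ)).re|) / (1 + ‖1 - conj (ρ : ℂ)‖) ^ 2)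
      ≤ (D.zeroMult ρ : ℝ) * (2 * (4 / (1 + ‖(ρ : ℂ)‖ ^ 2))) := by
        gcongr (D.zeroMult ρ : ℝ) * ?_
        calc (1 + |(1 - conj (ρ : ℂ)).re|) / (1 + ‖1 - conj (ρ : ℂ)‖) ^ 2
            ≤ 2 / (1 + ‖1 - conj (ρ : ℂ)‖) ^ 2 := by gcongr
          _ = 2 * (1 / (1 + ‖1 - conj (ρ : ℂ)‖) ^ 2) := by ring
          _ ≤ 2 * (4 / (1 + ‖(ρ : ℂ)‖ ^ 2)) := by
              gcongr 2 * ?_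
              rw [div_le_div_iff₀ hpos hpos']
              linarith
    _ = 8 * ((D.zeroMult ρ : ℝ) / (1 + ‖(ρ : ℂ)‖ ^ 2)) := by ring

/-- Under the convergence fact, Sekatskii's weight (ii) with `σ = ½` is summable for the non-trivial
zeros of `F` (`(1+|Re ρ|)/(1+|ρ+a−1|²) ≤ 2(2 + 2(a−1)²)/(1+|ρ|²)`).
[cite: Mazhouda2014LiSelberg, Lemma 1 (ii) (p. 6)] -/
theorem summable_sekatskiiWeight (h : D.LiZeroSumSummable) (a : ℝ) :
    Summable (Sekatskii.weight a (1 / 2) (fun ρ : D.nontrivialZeros ↦ (ρ : ℂ))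
      (fun ρ ↦ D.zeroMult ρ)) := by
  set K : ℝ := 2 + 2 * (a - 1) ^ 2 with hK
  refine Summable.of_nonneg_of_le (fun ρ ↦ Sekatskii.weight_nonneg _ _ _ _ ρ) (fun ρ ↦ ?_)
    (h.mul_left (2 * K))
  obtain ⟨-, h0, h1⟩ := ρ.2
  unfold Sekatskii.weight
  have hre : 1 + |(ρ : ℂ).re| ≤ 2 := by rw [abs_of_pos h0]; linarith
  have hsplit : (ρ : ℂ) = ((ρ : ℂ) + a - 2 * ((1 / 2 : ℝ) : ℂ)) + ((1 - a : ℝ) : ℂ) := by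
    push_cast; ring
  have htri : ‖(ρ : ℂ)‖ ≤ ‖(ρ : ℂ) + a - 2 * ((1 / 2 : ℝ) : ℂ)‖ + |1 - a| := by
    calc ‖(ρ : ℂ)‖ = ‖((ρ : ℂ) + a - 2 * ((1 / 2 : ℝ) : ℂ)) + ((1 - a : ℝ) : ℂ)‖ := by rw [← hsplit]
      _ ≤ ‖(ρ : ℂ) + a - 2 * ((1 / 2 : ℝ) : ℂ)‖ + ‖((1 - a : ℝ) : ℂ)‖ := norm_add_le _ _
      _ = _ := by rw [Complex.norm_real, Real.norm_eq_abs]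
  have hden : 1 + ‖(ρ : ℂ)‖ ^ 2 ≤ K * (1 + ‖(ρ : ℂ) + a - 2 * ((1 / 2 : ℝ) : ℂ)‖ ^ 2) := by
    have hsq : ‖(ρ : ℂ)‖ ^ 2 ≤ 2 * ‖(ρ : ℂ) + a - 2 * ((1 / 2 : ℝ) : ℂ)‖ ^ 2 + 2 * (1 - a) ^ 2 := by
      calc ‖(ρ : ℂ)‖ ^ 2 ≤ (‖(ρ : ℂ) + a - 2 * ((1 / 2 : ℝ) : ℂ)‖ + |1 - a|) ^ 2 :=
            pow_le_pow_left₀ (norm_nonneg _) htri 2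
        _ ≤ 2 * ‖(ρ : ℂ) + a - 2 * ((1 / 2 : ℝ) : ℂ)‖ ^ 2 + 2 * |1 - a| ^ 2 := by
            nlinarith [sq_nonneg (‖(ρ : ℂ) + a - 2 * ((1 / 2 : ℝ) : ℂ)‖ - |1 - a|)]
        _ = _ := by rw [sq_abs]
    rw [hK]
    nlinarith [sq_nonneg ‖(ρ : ℂ) + a - 2 * ((1 / 2 : ℝ) : ℂ)‖, sq_nonneg (a - 1)]
  have hpos : 0 < 1 + ‖(ρ : ℂ) + a - 2 * ((1 / 2 : ℝ) : ℂ)‖ ^ 2 := by positivity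
  have hpos' : 0 < 1 + ‖(ρ : ℂ)‖ ^ 2 := by positivity
  have hK0 : 0 < K := by positivity
  calc (D.zeroMult ρ : ℝ) * ((1 + |(ρ : ℂ).re|) / (1 + ‖(ρ : ℂ) + a - 2 * ((1 / 2 : ℝ) : ℂ)‖ ^ 2))
      ≤ (D.zeroMult ρ : ℝ) * (2 * (K / (1 + ‖(ρ : ℂ)‖ ^ 2))) := by
        gcongr (D.zeroMult ρ : ℝ) * ?_
        calc (1 + |(ρ : ℂ).re|) / (1 + ‖(ρ : ℂ) + a - 2 * ((1 / 2 : ℝ) : ℂ)‖ ^ 2)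
            ≤ 2 / (1 + ‖(ρ : ℂ) + a - 2 * ((1 / 2 : ℝ) : ℂ)‖ ^ 2) := by gcongr
          _ = 2 * (1 / (1 + ‖(ρ : ℂ) + a - 2 * ((1 / 2 : ℝ) : ℂ)‖ ^ 2)) := by ring
          _ ≤ 2 * (K / (1 + ‖(ρ : ℂ)‖ ^ 2)) := by
              gcongr 2 * ?_
              rw [div_le_div_iff₀ hpos hpos']
              linarith
    _ = 2 * K * ((D.zeroMult ρ : ℝ) / (1 + ‖(ρ : ℂ)‖ ^ 2)) := by ring

/-- **Absolute convergence of `Σ_ρ m(ρ)Re[1 − (1 − 1/ρ)ⁿ]`** under the convergence fact (p. 4).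
[cite: Mazhouda2014LiSelberg, §2 (p. 4)] -/
theorem summable_liTerm (h : D.LiZeroSumSummable) (n : ℕ) :
    Summable fun ρ : D.nontrivialZeros ↦ (D.zeroMult ρ : ℝ) * (1 - (1 - 1 / (ρ : ℂ)) ^ n).re :=
  BombieriLagarias.summable_term_pos (fun ρ ↦ zeroMult_pos ρ.2)
    (fun ρ ↦ (ne_zero_and_ne_one_of_mem ρ.2).1) (fun ρ ↦ (ne_zero_and_ne_one_of_mem ρ.2).2)
    (summable_blWeight_reflected h) n

/-! ### Theorem 1 — Li's criterion for the Selberg class -/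

/-- **Li's criterion for the Selberg class** (Omar–Mazhouda 2007, Thm 1; Smajlović 2010, Thm 4.3;
restated as Thm 1 of the secondary, p. 4: "Let `F(s)` be a function in the Selberg class `𝒮`
non-vanishing at `s = 1`.  Then, all non-trivial zeros of `F(s)` lie on the line `Re(s) = ½` if and
only if `Re(λ_F(n)) ≥ 0` for `n = 1, 2, …`" — printed with "`> 0`" in the secondary, `≥ 0` in
Li/Bombieri–Lagarias/Smajlović; the hypothesis "non-vanishing at `s = 1`" only serves to define
`log ξ_F` and is not needed for the zero-sum form).  PROVED for every Selberg datum, modulo the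
convergence fact `LiZeroSumSummable`, from the tree's `bombieriLagarias1999_theorem1_pos` applied to
the family of non-trivial zeros with multiplicities and the reflection `ρ ↦ 1 − ρ̄`.
[cite: OmarMazhouda2007, Thm 1; Mazhouda2014LiSelberg, Thm 1 (p. 4)] -/
theorem riemannHypothesis_iff_liCoeffRe_nonneg (h : D.LiZeroSumSummable) :
    D.RiemannHypothesis ↔ ∀ n : ℕ, 1 ≤ n → 0 ≤ D.liCoeffRe n := by
  rw [riemannHypothesis_iff_forall_half_le_re]
  exact bombieriLagarias1999_theorem1_pos (fun ρ : D.nontrivialZeros ↦ (ρ : ℂ))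
    (fun ρ ↦ D.zeroMult ρ) (fun ρ ↦ zeroMult_pos ρ.2)
    (fun ρ ↦ (ne_zero_and_ne_one_of_mem ρ.2).1) (fun ρ ↦ (ne_zero_and_ne_one_of_mem ρ.2).2)
    (summable_blWeight_reflected h)

/-- **`Re λ_F(n)` bounded below ⟹ RH_F** (the constant-bound case of Thm 1 (a)): a lower bound `−K`
uniform in `n ≥ 1` already gives the Riemann hypothesis for `F`. PROVED modulo `LiZeroSumSummable`
(`bombieriLagarias1999_theorem1_pos_of_bddBelow`). [cite: Mazhouda2014LiSelberg, Thm 1 (a) (p. 4)] -/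
theorem riemannHypothesis_of_liCoeffRe_bddBelow (h : D.LiZeroSumSummable) {K : ℝ}
    (hK : ∀ n : ℕ, 1 ≤ n → -K ≤ D.liCoeffRe n) : D.RiemannHypothesis :=
  riemannHypothesis_iff_forall_half_le_re.2 <|
    bombieriLagarias1999_theorem1_pos_of_bddBelow (fun ρ : D.nontrivialZeros ↦ (ρ : ℂ))
      (fun ρ ↦ D.zeroMult ρ) (fun ρ ↦ zeroMult_pos ρ.2)
      (fun ρ ↦ (ne_zero_and_ne_one_of_mem ρ.2).1) (fun ρ ↦ (ne_zero_and_ne_one_of_mem ρ.2).2)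
      (summable_blWeight_reflected h) hK

/-! ### Theorem 5 — the modified (Li–Sekatskii) criterion for the Selberg class -/

/-- `Re λ_F(n,a)` is the `σ = ½` Sekatskii family sum for the non-trivial zeros of `F`. [folklore] -/
private theorem liSekatskiiRe_eq_tsum (a : ℝ) (n : ℕ) :
    D.liSekatskiiRe a n = ∑' ρ : D.nontrivialZeros, (D.zeroMult ρ : ℝ) *
      (1 - (((ρ : ℂ) - a) / ((ρ : ℂ) + a - 2 * ((1 / 2 : ℝ) : ℂ))) ^ n).re := by
  unfold liSekatskiiRe
  refine tsum_congr fun ρ ↦ ?_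
  have : (ρ : ℂ) + a - 2 * ((1 / 2 : ℝ) : ℂ) = (ρ : ℂ) + a - 1 := by push_cast; ring
  rw [this]

/-- If `a ∉ Z(F)` then also `1 − a ∉ Z(F)` (reflection; `a` real), i.e. hypothesis (i) of the
modified Bombieri–Lagarias theorem holds: `ρ ≠ 1 − a` for every non-trivial zero.
[cite: Mazhouda2014LiSelberg, Thm 5 (hypothesis a ∉ Z(F)), Lemma 1 (i)] -/
theorem coe_ne_one_sub_of_not_mem {a : ℝ} (haZ : (a : ℂ) ∉ D.nontrivialZeros)
    (ρ : D.nontrivialZeros) : (ρ : ℂ) ≠ 2 * ((1 / 2 : ℝ) : ℂ) - a := by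
  intro hρ
  apply haZ
  have h := one_sub_conj_mem_nontrivialZeros ρ.2
  have h2 : 1 - conj (ρ : ℂ) = a := by
    rw [hρ]
    simp only [map_sub, map_mul, map_ofNat, Complex.conj_ofReal]
    push_cast
    ring
  rwa [h2] at h

/-- **The modified Li criterion for the Selberg class** (secondary, Thm 5, p. 6: "Let `a` be a real
number such that `a < ½` and `F ∈ 𝒮̃` be a function such that `a ∉ Z(F)`.  Then, all non-trivial
zeros of `F` lie on the line `Re(s) = ½` if and only if `Re(λ_F(n,a)) ≥ 0` for all `n ∈ ℕ`"; this is
Sekatskii's Theorem 1 for `F ∈ 𝒮` — the "Li–Sekatskii coefficients").  PROVED for every Selberg datum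
and every real `a ≠ ½` with `a ∉ Z(F)`, modulo the convergence fact `LiZeroSumSummable`, from the
tree's `sekatskii2014_thm2_of_lt/_gt` (no class `𝒮̃`/Euler-sum hypothesis is needed for the zero-sum
form).  TYPING NOTE: the secondary's footnote asserts "`≤ 0`" for `a > ½`; for the zero sums of its
abstract and §3 (typed here) the sign does NOT flip — `ρ ↦ 1 − ρ̄` gives `Re λ_F(n,1−a) = Re λ_F(n,a)`
— and the proved statement is `≥ 0` for all `a ≠ ½`; the flip belongs to the derivatives
`(1/(n−1)!) dⁿ/dsⁿ[(s−a)^{n−1} log ξ_F(s)]|_{s=1−a} = λ_F(n,a)/(1−2a)` (cf. `Sekatskii2014_sum_eq_deriv`;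
the secondary's displayed identity omits the factor `1−2a`, as its case `n = 1`,
`λ_F(1,a) = (1−2a)·(ξ_F′/ξ_F)(1−a)`, shows).
[cite: Mazhouda2014LiSelberg, Thm 5 (p. 6); Sekatskii2014, Thm 1] -/
theorem riemannHypothesis_iff_liSekatskiiRe_nonneg (h : D.LiZeroSumSummable) {a : ℝ} (ha : a ≠ 1 / 2)
    (haZ : (a : ℂ) ∉ D.nontrivialZeros) :
    D.RiemannHypothesis ↔ ∀ n : ℕ, 1 ≤ n → 0 ≤ D.liSekatskiiRe a n := by
  simp only [liSekatskiiRe_eq_tsum]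
  rcases lt_or_gt_of_ne ha with hlt | hgt
  · rw [riemannHypothesis_iff_forall_re_le_half]
    exact sekatskii2014_thm2_of_lt (fun ρ : D.nontrivialZeros ↦ (ρ : ℂ)) (fun ρ ↦ D.zeroMult ρ)
      hlt (fun ρ ↦ zeroMult_pos ρ.2) (fun ρ ↦ coe_ne_one_sub_of_not_mem haZ ρ)
      (summable_sekatskiiWeight h a)
  · rw [riemannHypothesis_iff_forall_half_le_re]
    exact sekatskii2014_thm2_of_gt (fun ρ : D.nontrivialZeros ↦ (ρ : ℂ)) (fun ρ ↦ D.zeroMult ρ)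
      hgt (fun ρ ↦ zeroMult_pos ρ.2) (fun ρ ↦ coe_ne_one_sub_of_not_mem haZ ρ)
      (summable_sekatskiiWeight h a)

/-- **Thm 1 (a): a subexponential lower bound suffices** (p. 4: "(a) For each `ε > 0`, there is a
positive constant `c(ε)` such that `Re(λ_F(n)) ≥ −c(ε)e^{εn}` for all `n ≥ 1`" is equivalent to RH for
`F`).  The non-trivial direction PROVED CONDITIONALLY on the named fact `Sekatskii2014_thm2c`
(Bombieri–Lagarias' condition (3)), applied with `a = 1`, `σ = ½` (ratio `(ρ−1)/ρ = 1 − 1/ρ`), modulo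
`LiZeroSumSummable`; hypothesis `1 ∉ Z(F)` is automatic. [cite: Mazhouda2014LiSelberg, Thm 1 (a) (p. 4)] -/
theorem riemannHypothesis_of_liCoeffRe_subexp (h2c : Sekatskii2014_thm2c.{0}) (h : D.LiZeroSumSummable)
    (hc : ∀ ε : ℝ, 0 < ε → ∃ c : ℝ, 0 < c ∧ ∀ n : ℕ, 1 ≤ n →
      -c * Real.exp (ε * n) ≤ D.liCoeffRe n) : D.RiemannHypothesis := by
  have h1Z : ((1 : ℝ) : ℂ) ∉ D.nontrivialZeros := by
    rintro ⟨-, -, h1⟩; simp at h1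
  have hEq : ∀ n : ℕ, (∑' ρ : D.nontrivialZeros, (D.zeroMult ρ : ℝ) *
      (1 - (((ρ : ℂ) - (1 : ℝ)) / ((ρ : ℂ) + (1 : ℝ) - 2 * ((1 / 2 : ℝ) : ℂ))) ^ n).re) =
        D.liCoeffRe n := by
    intro n
    unfold liCoeffRe
    refine tsum_congr fun ρ ↦ ?_
    have h0 : (ρ : ℂ) ≠ 0 := (ne_zero_and_ne_one_of_mem ρ.2).1
    congr 3
    push_cast
    field_simp
    ring
  have hc' : ∀ ε : ℝ, 0 < ε → ∃ c : ℝ, 0 < c ∧ ∀ n : ℕ, 1 ≤ n →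
      -c * Real.exp (ε * n) ≤ ∑' ρ : D.nontrivialZeros, (D.zeroMult ρ : ℝ) *
        (1 - (((ρ : ℂ) - (1 : ℝ)) / ((ρ : ℂ) + (1 : ℝ) - 2 * ((1 / 2 : ℝ) : ℂ))) ^ n).re := by
    intro ε hε
    obtain ⟨c, hc0, hcn⟩ := hc ε hε
    exact ⟨c, hc0, fun n hn ↦ by rw [hEq n]; exact hcn n hn⟩
  have := (h2c (fun ρ : D.nontrivialZeros ↦ (ρ : ℂ)) (fun ρ ↦ D.zeroMult ρ) 1 (1 / 2) (by norm_num)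
    (fun ρ ↦ zeroMult_pos ρ.2) (fun ρ ↦ coe_ne_one_sub_of_not_mem h1Z ρ)
    (summable_sekatskiiWeight h 1) hc').2 (by norm_num)
  exact riemannHypothesis_iff_forall_half_le_re.2 this

/-! ### Theorem 3 — the asymptotic criterion (Omar–Mazhouda II), named fact -/

variable (D)

/-- Omar–Mazhouda's constant `c_F = (d_F/2)(γ − 1) + ½ log(λ Q_F²)`, `λ = Π_j λ_j^{2λ_j}` (for `ζ`:
`½(γ − 1 − log 2π)`, the tree's `liC1`). [cite: OmarMazhouda2010, main theorem; Mazhouda2014LiSelberg, Thm 3 (p. 5)] -/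
def liAsymptoticConst : ℝ :=
  D.degree / 2 * (Real.eulerMascheroniConstant - 1) +
    1 / 2 * Real.log ((∏ j, D.lam j ^ (2 * D.lam j)) * D.Q ^ 2)

/-- **Omar–Mazhouda 2010 (II), main theorem** (Zbl 1188.11044; secondary Thm 3, p. 5: "Let `F ∈ 𝒮`.
Then `RH ⟺ λ_F(n) = (d_F/2) n log n + c_F n + O(√n log n)`, where
`c_F = (d_F/2)(γ−1) + ½ log(λ Q_F²)`, `λ = Π_{j=1}^r λ_j^{2λ_j}`") — NAMED FACT per datum, RH_F-EQUIVALENT,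
typed for the real parts `Re λ_F(n)` (`liCoeffRe`; the printed statement is for the complex
`λ_F(n)`, and implies this one: `⟹` by taking real parts, `⟸` because a lower bound already gives RH_F,
`riemannHypothesis_of_liCoeffRe_bddBelow`) and with the `O`-term as `∃ C, ∀ n ≥ 2, |…| ≤ C√n log n`.
Not proved here (Lagarias-type evaluation of the archimedean and Euler-sum parts of the explicit
formula). [cite: OmarMazhouda2010, main theorem; Mazhouda2014LiSelberg, Thm 3 (p. 5)] -/
def OmarMazhouda2010_liCoeff_asymptotic : Prop :=
  D.RiemannHypothesis ↔ ∃ C : ℝ, ∀ n : ℕ, 2 ≤ n →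
    |D.liCoeffRe n - (D.degree / 2 * n * Real.log n + D.liAsymptoticConst * n)| ≤
      C * Real.sqrt n * Real.log n

/-! ### Discharge of the convergence fact `LiZeroSumSummable` -/

variable {D}

/-- At a non-trivial zero, `zeroMult` (an `ℕ`) is the (non-negative) integer multiplicity
`(meromorphicOrderAt Φ_F ρ).untop₀` of the window-count lemma. [folklore] -/
private theorem cast_zeroMult_eq {ρ : ℂ} (h : ρ ∈ D.nontrivialZeros) :
    (D.zeroMult ρ : ℝ) = ((meromorphicOrderAt D.completed ρ).untop₀ : ℝ) := by
  obtain ⟨-, h0, h1⟩ := h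
  have hρne : ρ ≠ 1 := by rintro rfl; simp at h1
  have hΦ : AnalyticAt ℂ D.completed ρ := D.analyticOnNhd_completed ρ ⟨h0, hρne⟩
  have hnn : 0 ≤ (meromorphicOrderAt D.completed ρ).untop₀ :=
    WithTop.untop₀_nonneg.2 hΦ.meromorphicOrderAt_nonneg
  have hint : (((meromorphicOrderAt D.completed ρ).untop₀.toNat : ℕ) : ℤ) =
      (meromorphicOrderAt D.completed ρ).untop₀ := Int.toNat_of_nonneg hnn
  unfold zeroMult
  exact_mod_cast hint

/-- `1 + ⌊γ⌋² ≤ 4(1 + γ²)` for a real `γ`. [folklore] -/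
private theorem one_add_floor_sq_le (γ : ℝ) : 1 + (⌊γ⌋ : ℝ) ^ 2 ≤ 4 * (1 + γ ^ 2) := by
  have h1 : (⌊γ⌋ : ℝ) ≤ γ := Int.floor_le γ
  have h2 : γ < (⌊γ⌋ : ℝ) + 1 := Int.lt_floor_add_one γ
  rcases le_or_gt 0 (⌊γ⌋ : ℝ) with hf | hf
  · have : (⌊γ⌋ : ℝ) ^ 2 ≤ γ ^ 2 := pow_le_pow_left₀ hf h1 2
    nlinarith
  · have h3 : 0 ≤ -(⌊γ⌋ : ℝ) := by linarith
    have h4 : -(⌊γ⌋ : ℝ) < 1 - γ := by linarith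
    have : (⌊γ⌋ : ℝ) ^ 2 ≤ (1 - γ) ^ 2 := by
      have := pow_le_pow_left₀ h3 h4.le 2
      simpa [neg_sq] using this
    nlinarith [sq_nonneg (γ + 1 / 3)]

/-- The window bound summed over one fibre `⌊Im ρ⌋ = k` of a finite set of non-trivial zeros:
`Σ m(ρ)/(1+|ρ|²) ≤ 4C log(2+|k|)/(1+k²)`. [folklore] -/
private theorem sum_fiber_le {C : ℝ}
    (hwin : ∀ (t : ℝ) (S : Finset ℂ),
      (∀ ρ ∈ S, 0 < ρ.re ∧ ρ.re < 1 ∧ t ≤ ρ.im ∧ ρ.im ≤ t + 1) →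
      ∑ ρ ∈ S, ((meromorphicOrderAt D.completed ρ).untop₀ : ℝ) ≤ C * Real.log (2 + |t|))
    (u : Finset D.nontrivialZeros) (k : ℤ) :
    ∑ ρ ∈ u.filter (fun ρ : D.nontrivialZeros ↦ ⌊(ρ : ℂ).im⌋ = k),
        (D.zeroMult ρ : ℝ) / (1 + ‖(ρ : ℂ)‖ ^ 2) ≤
      4 * C * Real.log (2 + |(k : ℝ)|) / (1 + (k : ℝ) ^ 2) := by
  classical
  set uk := u.filter (fun ρ : D.nontrivialZeros ↦ ⌊(ρ : ℂ).im⌋ = k) with huk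
  -- the image in `ℂ` and the window bound
  set S : Finset ℂ := uk.image (fun ρ : D.nontrivialZeros ↦ (ρ : ℂ)) with hS
  have hSwin : ∀ ρ ∈ S, 0 < ρ.re ∧ ρ.re < 1 ∧ (k : ℝ) ≤ ρ.im ∧ ρ.im ≤ (k : ℝ) + 1 := by
    intro ρ hρ
    rw [hS, Finset.mem_image] at hρ
    obtain ⟨ρ', hρ', rfl⟩ := hρ
    rw [huk, Finset.mem_filter] at hρ'
    obtain ⟨-, h0, h1⟩ := ρ'.2
    refine ⟨h0, h1, ?_, ?_⟩
    · rw [← hρ'.2]; exact Int.floor_le _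
    · rw [← hρ'.2]; exact (Int.lt_floor_add_one _).le
  have hwinS := hwin k S hSwin
  have hsumS : ∑ ρ ∈ S, ((meromorphicOrderAt D.completed ρ).untop₀ : ℝ) =
      ∑ ρ ∈ uk, (D.zeroMult ρ : ℝ) := by
    rw [hS, Finset.sum_image (fun a _ b _ hab ↦ Subtype.ext hab)]
    exact Finset.sum_congr rfl fun ρ _ ↦ (cast_zeroMult_eq ρ.2).symm
  have hk0 : 0 < 1 + (k : ℝ) ^ 2 := by positivity
  -- termwise: `1/(1+|ρ|²) ≤ 4/(1+k²)` on the fibre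
  have hterm : ∀ ρ ∈ uk, (D.zeroMult ρ : ℝ) / (1 + ‖(ρ : ℂ)‖ ^ 2) ≤
      (D.zeroMult ρ : ℝ) * (4 / (1 + (k : ℝ) ^ 2)) := by
    intro ρ hρ
    rw [huk, Finset.mem_filter] at hρ
    have hfl := one_add_floor_sq_le (ρ : ℂ).im
    rw [hρ.2] at hfl
    have him : (ρ : ℂ).im ^ 2 ≤ ‖(ρ : ℂ)‖ ^ 2 := by
      have := Complex.abs_im_le_norm (ρ : ℂ)
      calc (ρ : ℂ).im ^ 2 = |(ρ : ℂ).im| ^ 2 := (sq_abs _).symm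
        _ ≤ ‖(ρ : ℂ)‖ ^ 2 := pow_le_pow_left₀ (abs_nonneg _) this 2
    have hpos : 0 < 1 + ‖(ρ : ℂ)‖ ^ 2 := by positivity
    rw [div_eq_mul_one_div]
    refine mul_le_mul_of_nonneg_left ?_ (Nat.cast_nonneg _)
    rw [div_le_div_iff₀ hpos hk0]
    nlinarith
  calc ∑ ρ ∈ uk, (D.zeroMult ρ : ℝ) / (1 + ‖(ρ : ℂ)‖ ^ 2)
      ≤ ∑ ρ ∈ uk, (D.zeroMult ρ : ℝ) * (4 / (1 + (k : ℝ) ^ 2)) := Finset.sum_le_sum hterm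
    _ = (∑ ρ ∈ uk, (D.zeroMult ρ : ℝ)) * (4 / (1 + (k : ℝ) ^ 2)) := by
        rw [Finset.sum_mul]
    _ ≤ (C * Real.log (2 + |(k : ℝ)|)) * (4 / (1 + (k : ℝ) ^ 2)) := by
        rw [← hsumS]
        exact mul_le_mul_of_nonneg_right hwinS (by positivity)
    _ = 4 * C * Real.log (2 + |(k : ℝ)|) / (1 + (k : ℝ) ^ 2) := by ring

/-- The majorant `k ↦ log(2+|k|)/(1+k²)` is summable over `ℤ` (compare with `(1+|k|)^{−3/2}`).
[folklore] -/
private theorem summable_log_div_one_add_sq :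
    Summable fun k : ℤ ↦ Real.log (2 + |(k : ℝ)|) / (1 + (k : ℝ) ^ 2) := by
  -- pointwise bound by `8 · ((1+|k|)^{3/2})⁻¹`
  have hbd : ∀ a : ℝ, 0 ≤ a →
      Real.log (2 + a) / (1 + a ^ 2) ≤ 8 * ((1 + a) ^ (3 / 2 : ℝ))⁻¹ := by
    intro a ha
    have h1a : 0 < 1 + a := by linarith
    have hlog : Real.log (2 + a) ≤ 2 * (2 + a) ^ (1 / 2 : ℝ) := by
      have := Real.log_le_rpow_div (x := 2 + a) (ε := 1 / 2) (by linarith) (by norm_num)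
      linarith [this]
    have hhalf : (2 + a) ^ (1 / 2 : ℝ) ≤ 2 * (1 + a) ^ (1 / 2 : ℝ) := by
      have h4 : (4 : ℝ) ^ (1 / 2 : ℝ) = 2 := by
        rw [show (4 : ℝ) = 2 ^ (2 : ℝ) by norm_num, ← Real.rpow_mul (by norm_num)]
        norm_num
      calc (2 + a) ^ (1 / 2 : ℝ) ≤ (4 * (1 + a)) ^ (1 / 2 : ℝ) :=
            Real.rpow_le_rpow (by linarith) (by linarith) (by norm_num)
        _ = 2 * (1 + a) ^ (1 / 2 : ℝ) := by
            rw [Real.mul_rpow (by norm_num) h1a.le, h4]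
    have hsq : (1 + a) ^ 2 ≤ 2 * (1 + a ^ 2) := by nlinarith [sq_nonneg (1 - a)]
    have hsplit : (1 + a) ^ (2 : ℝ) = (1 + a) ^ (1 / 2 : ℝ) * (1 + a) ^ (3 / 2 : ℝ) := by
      rw [← Real.rpow_add h1a]; norm_num
    have h32 : 0 < (1 + a) ^ (3 / 2 : ℝ) := Real.rpow_pos_of_pos h1a _
    have h12 : 0 < (1 + a) ^ (1 / 2 : ℝ) := Real.rpow_pos_of_pos h1a _
    have hpos : 0 < 1 + a ^ 2 := by positivity
    -- `log(2+a)/(1+a²) ≤ 4(1+a)^{1/2} · 2/(1+a)² = 8/(1+a)^{3/2}`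
    have hpow2 : (1 + a) ^ (2 : ℝ) = (1 + a) ^ 2 := by norm_cast
    calc Real.log (2 + a) / (1 + a ^ 2)
        ≤ (4 * (1 + a) ^ (1 / 2 : ℝ)) / (1 + a ^ 2) := by
          gcongr; linarith
      _ ≤ (4 * (1 + a) ^ (1 / 2 : ℝ)) * (2 / (1 + a) ^ 2) := by
          rw [div_eq_mul_one_div]
          refine mul_le_mul_of_nonneg_left ?_ (by positivity)
          rw [div_le_div_iff₀ hpos (by positivity)]
          linarith
      _ = 8 * ((1 + a) ^ (1 / 2 : ℝ) / (1 + a) ^ (2 : ℝ)) := by rw [hpow2]; ring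
      _ = 8 * ((1 + a) ^ (3 / 2 : ℝ))⁻¹ := by
          rw [hsplit, div_mul_cancel_left₀ h12.ne']
  -- summability of the majorant over `ℕ` (p-series, `p = 3/2`), shifted by one
  have hnat : Summable fun n : ℕ ↦ 8 * ((1 + (n : ℝ)) ^ (3 / 2 : ℝ))⁻¹ := by
    have hp : Summable fun n : ℕ ↦ (((n : ℝ)) ^ (3 / 2 : ℝ))⁻¹ :=
      Real.summable_nat_rpow_inv.2 (by norm_num)
    have := ((summable_nat_add_iff 1).2 hp).mul_left 8
    refine this.congr fun n ↦ ?_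
    push_cast
    ring_nf
  have hnn : ∀ k : ℤ, 0 ≤ Real.log (2 + |(k : ℝ)|) / (1 + (k : ℝ) ^ 2) := fun k ↦
    div_nonneg (Real.log_nonneg (by linarith [abs_nonneg (k : ℝ)])) (by positivity)
  refine Summable.of_nat_of_neg ?_ ?_
  · refine Summable.of_nonneg_of_le (fun n ↦ hnn n) (fun n ↦ ?_) hnat
    have : |((n : ℤ) : ℝ)| = (n : ℝ) := by push_cast; exact abs_of_nonneg (Nat.cast_nonneg _)
    rw [this]
    simpa using hbd n (Nat.cast_nonneg _)
  · refine Summable.of_nonneg_of_le (fun n ↦ hnn (-n)) (fun n ↦ ?_) hnat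
    have : |((-(n : ℤ) : ℤ) : ℝ)| = (n : ℝ) := by
      push_cast; rw [abs_neg]; exact abs_of_nonneg (Nat.cast_nonneg _)
    rw [this]
    have h2 : ((-(n : ℤ) : ℤ) : ℝ) ^ 2 = (n : ℝ) ^ 2 := by push_cast; ring
    rw [h2]
    exact hbd n (Nat.cast_nonneg _)

/-- **Discharge of `SelbergDatum.LiZeroSumSummable`**: for every `F ∈ 𝒮`,
`Σ_ρ m(ρ)/(1 + |ρ|²) < ∞` over the non-trivial zeros with multiplicity.  PROVED from the tree's
window count `SelbergDatum.exists_sum_order_window_le` (`Σ_{k ≤ Im ρ ≤ k+1} m(ρ) ≤ C log(2+|k|)`, Jensen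
+ convexity bound + Euler product): a finite partial sum is grouped by `k = ⌊Im ρ⌋`, each fibre
contributes `≤ 4C log(2+|k|)/(1+k²)`, and `Σ_{k∈ℤ} log(2+|k|)/(1+k²) < ∞`.  (The source's one-line
justification: "`ξ_F` is an entire function of order 1", p. 4.)
[cite: Mazhouda2014LiSelberg, §2 (p. 4); Smajlovic2010, §4] -/
theorem liZeroSumSummable_holds (D : SelbergDatum) : D.LiZeroSumSummable := by
  classical
  obtain ⟨C, hC, hwin⟩ := D.exists_sum_order_window_le
  set g : ℤ → ℝ := fun k ↦ 4 * C * Real.log (2 + |(k : ℝ)|) / (1 + (k : ℝ) ^ 2) with hg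
  have hg0 : ∀ k, 0 ≤ g k := fun k ↦ by
    rw [hg]
    exact div_nonneg (mul_nonneg (by positivity)
      (Real.log_nonneg (by linarith [abs_nonneg (k : ℝ)]))) (by positivity)
  have hgs : Summable g := by
    have := summable_log_div_one_add_sq.mul_left (4 * C)
    refine this.congr fun k ↦ ?_
    rw [hg]; ring
  refine summable_of_sum_le (c := ∑' k, g k) (fun ρ ↦ by positivity) fun u ↦ ?_
  rw [← Finset.sum_fiberwise_of_maps_to (g := fun ρ : D.nontrivialZeros ↦ ⌊(ρ : ℂ).im⌋)
    (t := u.image fun ρ : D.nontrivialZeros ↦ ⌊(ρ : ℂ).im⌋) (fun ρ hρ ↦ Finset.mem_image_of_mem _ hρ)]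
  calc ∑ k ∈ u.image (fun ρ : D.nontrivialZeros ↦ ⌊(ρ : ℂ).im⌋),
        ∑ ρ ∈ u.filter (fun ρ : D.nontrivialZeros ↦ ⌊(ρ : ℂ).im⌋ = k),
          (D.zeroMult ρ : ℝ) / (1 + ‖(ρ : ℂ)‖ ^ 2)
      ≤ ∑ k ∈ u.image (fun ρ : D.nontrivialZeros ↦ ⌊(ρ : ℂ).im⌋), g k :=
        Finset.sum_le_sum fun k _ ↦ by rw [hg]; exact sum_fiber_le hwin u k
    _ ≤ ∑' k, g k := hgs.sum_le_tsum _ fun k _ ↦ hg0 k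

/-! ### Unconditional forms of the criteria -/

/-- **Li's criterion for the Selberg class, unconditionally** (Omar–Mazhouda 2007, Thm 1 /
Smajlović 2010, Thm 4.3): for every Selberg datum, `RH_F ⟺ ∀ n ≥ 1, Re λ_F(n) ≥ 0`.  PROVED
(`riemannHypothesis_iff_liCoeffRe_nonneg` with `liZeroSumSummable_holds`).
[cite: OmarMazhouda2007, Thm 1; Smajlovic2010, Thm 4.3] -/
theorem riemannHypothesis_iff_liCoeffRe_nonneg' (D : SelbergDatum) :
    D.RiemannHypothesis ↔ ∀ n : ℕ, 1 ≤ n → 0 ≤ D.liCoeffRe n :=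
  riemannHypothesis_iff_liCoeffRe_nonneg D.liZeroSumSummable_holds

/-- **`Re λ_F(n)` bounded below ⟹ RH_F, unconditionally.** [cite: Mazhouda2014LiSelberg, Thm 1 (a) (p. 4)] -/
theorem riemannHypothesis_of_liCoeffRe_bddBelow' (D : SelbergDatum) {K : ℝ}
    (hK : ∀ n : ℕ, 1 ≤ n → -K ≤ D.liCoeffRe n) : D.RiemannHypothesis :=
  riemannHypothesis_of_liCoeffRe_bddBelow D.liZeroSumSummable_holds hK

/-- **The modified (Li–Sekatskii) criterion for the Selberg class, unconditionally**: for every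
Selberg datum, every real `a ≠ ½` with `a ∉ Z(F)`: `RH_F ⟺ ∀ n ≥ 1, Re λ_F(n,a) ≥ 0`.  PROVED.
[cite: Mazhouda2014LiSelberg, Thm 5 (p. 6); Sekatskii2014, Thm 1] -/
theorem riemannHypothesis_iff_liSekatskiiRe_nonneg' (D : SelbergDatum) {a : ℝ} (ha : a ≠ 1 / 2)
    (haZ : (a : ℂ) ∉ D.nontrivialZeros) :
    D.RiemannHypothesis ↔ ∀ n : ℕ, 1 ≤ n → 0 ≤ D.liSekatskiiRe a n :=
  riemannHypothesis_iff_liSekatskiiRe_nonneg D.liZeroSumSummable_holds ha haZ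

/-- **Absolute convergence of `Re λ_F(n)`**, unconditionally (p. 4: "converges absolutely for all
integer `n`"). [cite: Mazhouda2014LiSelberg, §2 (p. 4)] -/
theorem summable_liTerm' (D : SelbergDatum) (n : ℕ) :
    Summable fun ρ : D.nontrivialZeros ↦ (D.zeroMult ρ : ℝ) * (1 - (1 - 1 / (ρ : ℂ)) ^ n).re :=
  summable_liTerm D.liZeroSumSummable_holds n

/-- **Thm 1 (a) for the Selberg class, unconditionally**: if for every `ε > 0` there is `c(ε) > 0`
with `Re λ_F(n) ≥ −c(ε)e^{εn}` for all `n ≥ 1`, then RH_F.  PROVED (`Sekatskii2014_thm2c_holds`, i.e.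
Bombieri–Lagarias' condition (3), and `liZeroSumSummable_holds`).
[cite: Mazhouda2014LiSelberg, Thm 1 (a) (p. 4); BombieriLagarias1999, Theorem 1] -/
theorem riemannHypothesis_of_liCoeffRe_subexp' (D : SelbergDatum)
    (hc : ∀ ε : ℝ, 0 < ε → ∃ c : ℝ, 0 < c ∧ ∀ n : ℕ, 1 ≤ n →
      -c * Real.exp (ε * n) ≤ D.liCoeffRe n) : D.RiemannHypothesis :=
  riemannHypothesis_of_liCoeffRe_subexp Sekatskii2014_thm2c_holds D.liZeroSumSummable_holds hc

/-! ### The `⟸` half of the asymptotic criterion (Omar–Mazhouda II), proved -/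

/-- **A polynomial lower bound for `Re λ_F(n)` already gives RH_F**: if `Re λ_F(n) ≥ −K·n^k` for all
`n ≥ 1`, then the Riemann hypothesis holds for `F` — a polynomial bound is sub-exponential
(`n^k ≤ k!·ε^{−k}·e^{εn}`), and Thm 1 (a) / Bombieri–Lagarias' condition (3) applies
(`riemannHypothesis_of_liCoeffRe_subexp'`).  PROVED; an RH_F-FREE implication whose hypothesis is
of RH_F strength. [cite: Mazhouda2014LiSelberg, Thm 1 (a) (p. 4); BombieriLagarias1999, Theorem 1] -/
theorem riemannHypothesis_of_liCoeffRe_ge_neg_pow (D : SelbergDatum) {K : ℝ} {k : ℕ}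
    (hK : ∀ n : ℕ, 1 ≤ n → -(K * (n : ℝ) ^ k) ≤ D.liCoeffRe n) : D.RiemannHypothesis := by
  refine D.riemannHypothesis_of_liCoeffRe_subexp' fun ε hε ↦ ?_
  refine ⟨|K| * (k.factorial : ℝ) / ε ^ k + 1, by positivity, fun n hn ↦ ?_⟩
  have hεk : 0 < ε ^ k := by positivity
  have hk : (0 : ℝ) < (k.factorial : ℝ) := by positivity
  have hexp0 : 0 < Real.exp (ε * n) := Real.exp_pos _
  -- `(εn)^k / k! ≤ e^{εn}`, i.e. `n^k ≤ (k!/ε^k) e^{εn}`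
  have hexp : (ε * n) ^ k / (k.factorial : ℝ) ≤ Real.exp (ε * n) :=
    Real.pow_div_factorial_le_exp (ε * n) (by positivity) k
  have hnk : (n : ℝ) ^ k ≤ (k.factorial : ℝ) / ε ^ k * Real.exp (ε * n) := by
    rw [div_le_iff₀ hk, mul_pow] at hexp
    rw [div_mul_eq_mul_div, le_div_iff₀ hεk]
    linarith
  have hKle : K * (n : ℝ) ^ k ≤ |K| * ((k.factorial : ℝ) / ε ^ k * Real.exp (ε * n)) :=
    (mul_le_mul_of_nonneg_right (le_abs_self K) (by positivity)).trans
      (mul_le_mul_of_nonneg_left hnk (abs_nonneg K))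
  have h := hK n hn
  rw [neg_mul]
  have : |K| * ((k.factorial : ℝ) / ε ^ k * Real.exp (ε * n)) ≤
      (|K| * (k.factorial : ℝ) / ε ^ k + 1) * Real.exp (ε * n) := by
    rw [add_mul, one_mul]
    have : |K| * ((k.factorial : ℝ) / ε ^ k * Real.exp (ε * n)) = |K| * (k.factorial : ℝ) / ε ^ k * Real.exp (ε * n) := by
      ring
    linarith
  linarith

/-- **Omar–Mazhouda 2010 (II), main theorem — the `⟸` half, PROVED** (secondary Thm 3, p. 5): if
`Re λ_F(n) = (d_F/2) n log n + c_F n + O(√n log n)` in the typed sense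
(`|Re λ_F(n) − (d_F/2) n log n − c_F n| ≤ C√n log n` for `n ≥ 2`, any `C`), then RH_F: with
`d_F ≥ 0` (`degree_nonneg`), `√n ≤ n` and `log n ≤ n` the asymptotic gives `Re λ_F(n) ≥ −K n²`,
and a polynomial lower bound suffices (`riemannHypothesis_of_liCoeffRe_ge_neg_pow`).  The `⟹` half
(the Lagarias-type evaluation of the archimedean and Euler-sum parts under RH_F) remains the named
fact `OmarMazhouda2010_liCoeff_asymptotic`.
[cite: OmarMazhouda2010, main theorem (⟸ direction); Mazhouda2014LiSelberg, Thm 3 (p. 5)] -/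
theorem riemannHypothesis_of_liCoeff_asymptotic (D : SelbergDatum) {C : ℝ}
    (hC : ∀ n : ℕ, 2 ≤ n →
      |D.liCoeffRe n - (D.degree / 2 * n * Real.log n + D.liAsymptoticConst * n)| ≤
        C * Real.sqrt n * Real.log n) :
    D.RiemannHypothesis := by
  refine D.riemannHypothesis_of_liCoeffRe_ge_neg_pow
    (K := |D.liAsymptoticConst| + |C| + |D.liCoeffRe 1|) (k := 2) fun n hn ↦ ?_
  rcases Nat.lt_or_ge n 2 with h1 | h2
  · obtain rfl : n = 1 := by omega
    simp only [Nat.cast_one, one_pow, mul_one]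
    have := neg_abs_le (D.liCoeffRe 1)
    have h0 : 0 ≤ |D.liAsymptoticConst| + |C| := by positivity
    linarith
  · have hn1 : (1 : ℝ) ≤ n := by exact_mod_cast hn
    have hn0 : (0 : ℝ) < n := by linarith
    have hb := (abs_le.1 (hC n h2)).1
    have hlog0 : 0 ≤ Real.log n := Real.log_nonneg hn1
    have hlogle : Real.log n ≤ n := (Real.log_le_sub_one_of_pos hn0).trans (by linarith)
    have hsqrtle : Real.sqrt n ≤ n := Real.sqrt_le_iff.2 ⟨hn0.le, by nlinarith⟩
    have hd : 0 ≤ D.degree / 2 * n * Real.log n := by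
      have := D.degree_nonneg; positivity
    have hc : -(|D.liAsymptoticConst| * (n : ℝ) ^ 2) ≤ D.liAsymptoticConst * n := by
      have h1 : -|D.liAsymptoticConst| * n ≤ D.liAsymptoticConst * n :=
        mul_le_mul_of_nonneg_right (neg_abs_le D.liAsymptoticConst) hn0.le
      have h2 : |D.liAsymptoticConst| * n ≤ |D.liAsymptoticConst| * (n : ℝ) ^ 2 :=
        mul_le_mul_of_nonneg_left (by nlinarith) (abs_nonneg D.liAsymptoticConst)
      linarith
    have hC' : C * Real.sqrt n * Real.log n ≤ |C| * (n : ℝ) ^ 2 := by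
      calc C * Real.sqrt n * Real.log n ≤ |C| * Real.sqrt n * Real.log n := by
            gcongr; exact le_abs_self C
        _ ≤ |C| * n * n := by gcongr
        _ = |C| * (n : ℝ) ^ 2 := by ring
    have h1' : 0 ≤ |D.liCoeffRe 1| * (n : ℝ) ^ 2 := by positivity
    linarith

/-- The `⟸` half of the named fact, packaged: `OmarMazhouda2010_liCoeff_asymptotic D` holds as soon as
its `⟹` half does. [cite: OmarMazhouda2010, main theorem; Mazhouda2014LiSelberg, Thm 3 (p. 5)] -/
theorem omarMazhouda2010_liCoeff_asymptotic_of_onlyIf (D : SelbergDatum)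
    (h : D.RiemannHypothesis → ∃ C : ℝ, ∀ n : ℕ, 2 ≤ n →
      |D.liCoeffRe n - (D.degree / 2 * n * Real.log n + D.liAsymptoticConst * n)| ≤
        C * Real.sqrt n * Real.log n) :
    D.OmarMazhouda2010_liCoeff_asymptotic :=
  ⟨h, fun ⟨_, hC⟩ ↦ D.riemannHypothesis_of_liCoeff_asymptotic hC⟩

end SelbergDatum

end Literature.NumberTheory.LFunctions
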